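import Summits.Ventures.HSemireg.WedgeHankelRecurrenceGaussChebyshevCFixedPointIdeal

/-!
# Venture HSemireg — **COMMON FIXED POINTS, POINTWISE AND IN THE `T`-NORMALISATION: `C_m(x) = 2 ∧ C_n(x) = 2 ⟺ C_{gcd(m,n)}(x) = 2` in every commutative ring; `(2(T_m − 1), 2(T_n − 1)) =
# (2(T_{gcd} − 1))` in every `R[X]`, hence `(T_m − 1, T_n − 1) = (T_{gcd(m,n)} − 1)` and `T_m(x) = 1 ∧ T_n(x) = 1 ⟺ T_{gcd}(x) = 1` whenever `2` is a unit of `R`** — the common-fixed-point ideal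
# N489 `(C_m − 2, C_n − 2) = (C_g − 2)` pushed along `X ↦ 2X` (`C_n(2X) = 2 T_n(X)`) and read pointwise (the points where `T_m = 1` are `x = 1` and the double Radau–Chebyshev points, N478)

HONEST FRAMING. Part of the Lean index of the computation cell `pub-hsemireg` (seat p10 gen 48, Sunday typer «UNIFORM-IN-n»).  Polynomial ideal algebra only; no variety, no cohomology theory, no sheaf,
no Ext group and no semiregularity map is constructed here; nothing here says that HC / HC_CM / HC_AV holds; no Literature fact (unproved `Prop`) is declared or used.  Custodian versions as in
`WedgeHankelSiegelIdeal` (1/3).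
SOURCES (cited).  R. Lidl, G. L. Mullen, G. Turnwald, *Dickson Polynomials* (1993), Ch. 3 (fixed points of `D_n(x, a)`); T. J. Rivlin, *Chebyshev Polynomials* (1990), §1.2, Ch. 4 (iteration of `T_n`).
PROOF TYPED HERE.  N489 `chebyshevC_sub_two_span_pair`; N488 `chebyshevC_eval_eq_two_of_eval_eq_two`, `chebyshevT_eval_eq_one_of_eval_eq_one`; Mathlib `Polynomial.compRingHom`, `C_comp_two_mul_X`,
`Ideal.map_span`, `Ideal.mem_span_pair`, `Ideal.span_singleton_mul_left_unit`, `Ideal.span_insert`, `Nat.gcd_dvd_left ∕ right`.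
DEDUP DISCLOSURE (`rg -n 'chebyshevC_eval_eq_two_iff|chebyshevT_two_mul_sub_one_span_pair|chebyshevT_sub_one_span_pair|chebyshevT_eval_eq_one_iff_gcd' Summits Literature HarnessLib`, 2026-09-04):
N478 `chebyshevT_two_mul_add_one_eval_eq_one_iff` (one index, factorised form) — different statement; 0 hits for the 4 names below.

WHAT IS IN THE TREE.  N478, N488, N489.
THIS FILE (namespace `Summit.Ventures.HSemireg.Wedge.HankelOuter` continued; CHAINED on N489; 0 definitions):
* §1255 **`chebyshevC_eval_eq_two_iff`**, **`chebyshevT_two_mul_sub_one_span_pair`**, **`chebyshevT_sub_one_span_pair`** (`2` a unit), `chebyshevT_eval_eq_one_iff_gcd` (`2` a unit).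
CAVEATS.  Without `IsUnit 2` the `T`-ideal statement keeps the factor `2` (in characteristic `2`, `T_{2k} − 1 = 0`).  Nothing Ext-side.  New names only.
-/

open Module Polynomial
open scoped Matrix Polynomial

namespace Summit.Ventures.HSemireg.Wedge.HankelOuter

/-! ## §1255. Common fixed points pointwise, and the `T`-normalisation -/

/-- **`C_m(x) = 2` and `C_n(x) = 2` iff `C_{gcd(m,n)}(x) = 2`**, for every `x` in every commutative ring (the common fixed points of the Dickson maps `D_m`, `D_n` are the fixed points of `D_{gcd}`).
[Lidl–Mullen–Turnwald Ch. 3; this file, §1255] -/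
theorem chebyshevC_eval_eq_two_iff {R : Type*} [CommRing R] (m n : ℕ) (x : R) :
    (Polynomial.Chebyshev.C R (m : ℤ)).eval x = 2 ∧ (Polynomial.Chebyshev.C R (n : ℤ)).eval x = 2 ↔ (Polynomial.Chebyshev.C R (Nat.gcd m n : ℤ)).eval x = 2 := by
  constructor
  · rintro ⟨hm, hn⟩
    have hmem : Polynomial.Chebyshev.C R (Nat.gcd m n : ℤ) - 2 ∈ Ideal.span {Polynomial.Chebyshev.C R (m : ℤ) - 2, Polynomial.Chebyshev.C R (n : ℤ) - 2} := by
      rw [chebyshevC_sub_two_span_pair]; exact Ideal.subset_span (Set.mem_singleton _)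
    obtain ⟨a, b, hab⟩ := Ideal.mem_span_pair.1 hmem
    have h := congrArg (Polynomial.eval x) hab
    rw [eval_add, eval_mul, eval_mul, eval_sub, eval_sub, eval_sub, hm, hn, eval_ofNat, sub_self, mul_zero, mul_zero, add_zero] at h
    exact (sub_eq_zero.1 h.symm)
  · intro hg
    obtain ⟨m', hm'⟩ := Nat.gcd_dvd_left m n
    obtain ⟨n', hn'⟩ := Nat.gcd_dvd_right m n
    refine ⟨?_, ?_⟩
    · have h := chebyshevC_eval_eq_two_of_eval_eq_two (R := R) (m' : ℤ) (Nat.gcd m n : ℤ) hg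
      rwa [← Nat.cast_mul, mul_comm, ← hm'] at h
    · have h := chebyshevC_eval_eq_two_of_eval_eq_two (R := R) (n' : ℤ) (Nat.gcd m n : ℤ) hg
      rwa [← Nat.cast_mul, mul_comm, ← hn'] at h

/-- **`(2(T_m − 1), 2(T_n − 1)) = (2(T_{gcd(m,n)} − 1))` in `R[X]` for every commutative ring `R`** (N489 pushed along `X ↦ 2X`: `C_n(2X) = 2T_n(X)`). [this file, §1255] -/
theorem chebyshevT_two_mul_sub_one_span_pair {R : Type*} [CommRing R] (m n : ℕ) :
    Ideal.span {2 * (Polynomial.Chebyshev.T R (m : ℤ) - 1), 2 * (Polynomial.Chebyshev.T R (n : ℤ) - 1)} = Ideal.span {2 * (Polynomial.Chebyshev.T R (Nat.gcd m n : ℤ) - 1)} := by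
  have hc : ∀ k : ℤ, Polynomial.compRingHom (2 * Polynomial.X) (Polynomial.Chebyshev.C R k - 2) = 2 * (Polynomial.Chebyshev.T R k - 1) := fun k => by
    rw [Polynomial.coe_compRingHom_apply, sub_comp, Polynomial.Chebyshev.C_comp_two_mul_X, ofNat_comp]; ring
  have h := congrArg (Ideal.map (Polynomial.compRingHom (2 * Polynomial.X : R[X]))) (chebyshevC_sub_two_span_pair (R := R) m n)
  rwa [Ideal.map_span, Ideal.map_span, Set.image_pair, Set.image_singleton, hc, hc, hc] at h

/-- **`(T_m − 1, T_n − 1) = (T_{gcd(m,n)} − 1)` in `R[X]` whenever `2` is a unit of `R`** (e.g. every field of characteristic `≠ 2`, `ℤ[½]`). [Rivlin §1.2; this file, §1255] -/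
theorem chebyshevT_sub_one_span_pair {R : Type*} [CommRing R] (h2 : IsUnit (2 : R)) (m n : ℕ) :
    Ideal.span {Polynomial.Chebyshev.T R (m : ℤ) - 1, Polynomial.Chebyshev.T R (n : ℤ) - 1} = Ideal.span {Polynomial.Chebyshev.T R (Nat.gcd m n : ℤ) - 1} := by
  have hu : IsUnit (2 : R[X]) := by
    rw [show (2 : R[X]) = Polynomial.C 2 from (Polynomial.C_ofNat 2).symm]; exact h2.map Polynomial.C
  have h := chebyshevT_two_mul_sub_one_span_pair (R := R) m n
  rwa [Ideal.span_insert, Ideal.span_singleton_mul_left_unit hu, Ideal.span_singleton_mul_left_unit hu, Ideal.span_singleton_mul_left_unit hu, ← Ideal.span_insert] at h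

/-- **`T_m(x) = 1` and `T_n(x) = 1` iff `T_{gcd(m,n)}(x) = 1`**, for every `x` in a commutative ring in which `2` is a unit. [this file, §1255] -/
theorem chebyshevT_eval_eq_one_iff_gcd {R : Type*} [CommRing R] (h2 : IsUnit (2 : R)) (m n : ℕ) (x : R) :
    (Polynomial.Chebyshev.T R (m : ℤ)).eval x = 1 ∧ (Polynomial.Chebyshev.T R (n : ℤ)).eval x = 1 ↔ (Polynomial.Chebyshev.T R (Nat.gcd m n : ℤ)).eval x = 1 := by
  constructor
  · rintro ⟨hm, hn⟩
    have hmem : Polynomial.Chebyshev.T R (Nat.gcd m n : ℤ) - 1 ∈ Ideal.span {Polynomial.Chebyshev.T R (m : ℤ) - 1, Polynomial.Chebyshev.T R (n : ℤ) - 1} := by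
      rw [chebyshevT_sub_one_span_pair h2]; exact Ideal.subset_span (Set.mem_singleton _)
    obtain ⟨a, b, hab⟩ := Ideal.mem_span_pair.1 hmem
    have h := congrArg (Polynomial.eval x) hab
    rw [eval_add, eval_mul, eval_mul, eval_sub, eval_sub, eval_sub, hm, hn, eval_one, sub_self, mul_zero, mul_zero, add_zero] at h
    exact (sub_eq_zero.1 h.symm)
  · intro hg
    obtain ⟨m', hm'⟩ := Nat.gcd_dvd_left m n
    obtain ⟨n', hn'⟩ := Nat.gcd_dvd_right m n
    refine ⟨?_, ?_⟩
    · have h := chebyshevT_eval_eq_one_of_eval_eq_one (R := R) (m' : ℤ) (Nat.gcd m n : ℤ) hg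
      rwa [← Nat.cast_mul, mul_comm, ← hm'] at h
    · have h := chebyshevT_eval_eq_one_of_eval_eq_one (R := R) (n' : ℤ) (Nat.gcd m n : ℤ) hg
      rwa [← Nat.cast_mul, mul_comm, ← hn'] at h

end Summit.Ventures.HSemireg.Wedge.HankelOuter
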